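import Summits.AtomisticToContinuum.FouriersLaw.Theses.PorousMediumCorner
import Summits.AtomisticToContinuum.FouriersLaw.Theorems.EmbeddedDrudeMourreAbelOfSpectralDensity
import HarnessLib

/-!
# `PorousMediumCorner.AnchorAbelGreenKubo` (stmt-AtomisticToContinuum-9790) — the typed split, PROVED

Crux-strategist decomposition (D-0027 A7 / BC2 redirect) of the deciding crux `AnchorAbelGreenKubo` of
route `PorousMediumCorner` (sub-problem `FouriersLaw`) along the frequency-`0` SPECTRAL seam of the
summed current autocorrelation `C(t) = Σ_x ∫ j₀ (j_x ∘ φ_t) dρ` of the infinite purely quartic ("anchor")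
chain `U = μq⁴/4`, `V = r⁴/4` at temperature `1`:

* X₀ `AnchorSpectralSetup` — a shift-invariant DLR state `ρ`, a `ρ`-preserving infinite-volume
  dynamics `D` with absolutely convergent `C`, and a finite spectral measure `σ` with
  `C(t) = ∫ cos(ωt) dσ(ω)` (Bochner);
* X₁ `AnchorLowFrequencyWindow` — for every admissible EVEN representation: a window `(−δ, δ)` on
  which `σ = σ{0}·δ₀ + g dω`, `g` continuous `≥ 0` (limiting absorption at frequency `0`, atom allowed);
* X₂ `AnchorNoDrudeWeight` — for every admissible representation: `σ{0} = 0` (no hidden odd charge);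
* X₃ `AnchorPositiveDensity` — for every admissible representation and window density (no atom):
  `0 < g 0` (not an insulator).

`anchorAbelGreenKubo_of_subs : X₀ → X₁ → X₂ → X₃ → AnchorAbelGreenKubo`: symmetrise `σ`
(`exists_even_measure_integral_cos_eq`), read the window, kill the atom, read `g 0 > 0`, and COMPUTE the
Abel limit `∫₀^∞ e^{−νt} C(t) dt → π·g 0` (`ν ↓ 0`) by the Poisson-kernel Abelian lemma (the landed
proof `AbelOfSpectralDensity.abelOfSpectralDensity_proof` of stmt-12598); `κ₀ := π·g 0 > 0`.
The four hypotheses are spelled out verbatim (they become route items `PorousMediumCorner.X₀…X₃` by the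
`route edit --split AnchorAbelGreenKubo` that this file certifies; the generated glue item is then this
theorem by definitional unfolding).
-/

noncomputable section

namespace Summit.AtomisticToContinuum.FouriersLaw.Theorems.PorousMediumCornerSplit

open MeasureTheory Filter Set Topology
open scoped NNReal ENNReal

/-- **Symmetrisation of a spectral measure.** For a finite measure `σ` on `ℝ` the measure
`σ' := ½ (σ + σ ∘ (ω ↦ -ω)⁻¹)` is finite, even, and has the same cosine transform. [folklore] -/
theorem exists_even_measure_integral_cos_eq (σ : Measure ℝ) [IsFiniteMeasure σ] :
    ∃ σ' : Measure ℝ, IsFiniteMeasure σ' ∧ σ'.map (fun ω : ℝ => -ω) = σ' ∧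
      ∀ t : ℝ, ∫ ω, Real.cos (ω * t) ∂σ' = ∫ ω, Real.cos (ω * t) ∂σ := by
  have hme : Measurable (fun ω : ℝ => -ω) := measurable_neg
  have hemb : MeasurableEmbedding (fun ω : ℝ => -ω) := (Homeomorph.neg ℝ).measurableEmbedding
  have hinv : (fun ω : ℝ => -ω) ∘ (fun ω : ℝ => -ω) = id := by
    funext ω
    simp
  refine ⟨(2⁻¹ : ℝ≥0) • (σ + σ.map (fun ω : ℝ => -ω)), inferInstance, ?_, fun t => ?_⟩
  · rw [Measure.map_smul, Measure.map_add _ _ hme, Measure.map_map hme hme, hinv, Measure.map_id,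
      add_comm]
  · have hint : ∀ μ : Measure ℝ, IsFiniteMeasure μ → Integrable (fun ω : ℝ => Real.cos (ω * t)) μ := by
      intro μ _
      refine (integrable_const (1 : ℝ)).mono' (by fun_prop) (ae_of_all _ fun ω => ?_)
      rw [Real.norm_eq_abs]
      exact Real.abs_cos_le_one _
    rw [integral_smul_nnreal_measure, integral_add_measure (hint σ inferInstance)
      (hint _ inferInstance), hemb.integral_map]
    simp only [neg_mul, Real.cos_neg]
    rw [NNReal.smul_def, smul_eq_mul]
    push_cast
    ring

/-- **The Poisson-kernel Abelian lemma** in Literature vocabulary (the landed proof of item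
stmt-AtomisticToContinuum-12598, `abelOfSpectralDensity_proof`, unfolded): a finite measure `σ` whose
restriction to `(−δ, δ)` has a continuous non-negative Lebesgue density `g` has Abel means
`∫₀^∞ e^{−νt} (∫ cos(ωt) dσ) dt → π·g 0` as `ν ↓ 0`. [folklore] -/
theorem abel_of_spectralDensity (σ : Measure ℝ) (C : ℝ → ℝ) (δ : ℝ) (g : ℝ → ℝ)
    (hfin : IsFiniteMeasure σ) (hδ : 0 < δ) (hC : ∀ t : ℝ, C t = ∫ ω, Real.cos (ω * t) ∂σ)
    (hg : ContinuousOn g (Ioo (-δ) δ)) (hg0 : ∀ ω ∈ Ioo (-δ) δ, 0 ≤ g ω)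
    (hres : σ.restrict (Ioo (-δ) δ) = (volume.restrict (Ioo (-δ) δ)).withDensity
      (fun ω => ENNReal.ofReal (g ω))) :
    Tendsto (fun ν : ℝ => ∫ t in Ioi (0:ℝ), Real.exp (-(ν * t)) * C t) (𝓝[>] 0)
      (𝓝 (Real.pi * g 0)) := by
  have h := Summit.AtomisticToContinuum.FouriersLaw.Theorems.AbelOfSpectralDensity.abelOfSpectralDensity_proof
  unfold Summit.AtomisticToContinuum.FouriersLaw.Theses.EmbeddedDrudeMourre.AbelOfSpectralDensity at h
  exact h σ C δ g hfin hδ hC hg hg0 hres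

/-- **The split of `AnchorAbelGreenKubo`, proved** (BC2 redirect of stmt-AtomisticToContinuum-9790):
`AnchorSpectralSetup → AnchorLowFrequencyWindow → AnchorNoDrudeWeight → AnchorPositiveDensity →
AnchorAbelGreenKubo`, the four hypotheses being spelled out verbatim (they are the children installed by
`route edit --split`). For `μ > 0` and any `γ`: take the spectral set-up `(ρ, D, σ₀)`; symmetrise `σ₀` to an
even `σ` with the same cosine transform; the low-frequency window gives `σ|(−δ,δ) = σ{0}·δ₀ + g dω`; no Drude
weight kills the atom; positive density gives `g 0 > 0`; the Poisson-kernel Abelian lemma computes the Abel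
limit `π·g 0` of `∫₀^∞ e^{−νt} C(t) dt`; hence `AnchorAbelGreenKubo` with the same `(ρ, D)` and
`κ₀ = π·g 0`. [folklore] -/
theorem anchorAbelGreenKubo_of_subs :
    (∀ μ γ : ℝ, 0 < μ → ∃ (ρ : MeasureTheory.Measure Literature.MathematicalPhysics.KineticTheory.HeatConduction.ChainConfig) (D : Literature.MathematicalPhysics.KineticTheory.HeatConduction.InfiniteChainDynamics (Literature.MathematicalPhysics.KineticTheory.HeatConduction.OscillatorChain.mk (fun q => μ * q ^ 4 / 4) (fun r => r ^ 4 / 4) γ)), (Literature.MathematicalPhysics.KineticTheory.HeatConduction.OscillatorChain.mk (fun q => μ * q ^ 4 / 4) (fun r => r ^ 4 / 4) γ).IsChainGibbsMeasure 1 ρ ∧ (∀ x : ℤ, MeasureTheory.MeasurePreserving (fun σ : Literature.MathematicalPhysics.KineticTheory.HeatConduction.ChainConfig => fun i : ℤ => σ (i + x)) ρ ρ) ∧ D.PreservesMeasure ρ ∧ (∀ t : ℝ, D.HasAbsConvergentCorrelation ρ t) ∧ ∃ σ : MeasureTheory.Measure ℝ, MeasureTheory.IsFiniteMeasure σ ∧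 ∀ t : ℝ, D.currentCorrelation ρ t = MeasureTheory.integral σ (fun ω : ℝ => Real.cos (ω * t))) →
    (∀ μ γ : ℝ, 0 < μ → ∀ (ρ : MeasureTheory.Measure Literature.MathematicalPhysics.KineticTheory.HeatConduction.ChainConfig) (D : Literature.MathematicalPhysics.KineticTheory.HeatConduction.InfiniteChainDynamics (Literature.MathematicalPhysics.KineticTheory.HeatConduction.OscillatorChain.mk (fun q => μ * q ^ 4 / 4) (fun r => r ^ 4 / 4) γ)), (Literature.MathematicalPhysics.KineticTheory.HeatConduction.OscillatorChain.mk (fun q => μ * q ^ 4 / 4) (fun r => r ^ 4 / 4) γ).IsChainGibbsMeasure 1 ρ → (∀ x : ℤ, MeasureTheory.MeasurePreserving (fun σ : Literature.MathematicalPhysics.KineticTheory.HeatConduction.ChainConfig => fun i : ℤ => σ (i + x)) ρ ρ) → D.PreservesMeasure ρ → (∀ t : ℝ, D.HasAbsConvergentCorrelation ρ t) → ∀ σ : MeasureTheory.Measure ℝ, MeasureTheory.IsFiniteMeasure σ → MeasureTheory.Measure.map (fun ω : ℝ => -ω) σ = σ → (∀ t : ℝ, D.currentCorrelation ρ t = MeasureTheory.integral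 σ (fun ω : ℝ => Real.cos (ω * t))) → ∃ (δ : ℝ) (g : ℝ → ℝ), 0 < δ ∧ ContinuousOn g (Set.Ioo (-δ) δ) ∧ (∀ ω ∈ Set.Ioo (-δ) δ, 0 ≤ g ω) ∧ σ.restrict (Set.Ioo (-δ) δ) = σ {0} • MeasureTheory.Measure.dirac 0 + (MeasureTheory.volume.restrict (Set.Ioo (-δ) δ)).withDensity (fun ω => ENNReal.ofReal (g ω))) →
    (∀ μ γ : ℝ, 0 < μ → ∀ (ρ : MeasureTheory.Measure Literature.MathematicalPhysics.KineticTheory.HeatConduction.ChainConfig) (D : Literature.MathematicalPhysics.KineticTheory.HeatConduction.InfiniteChainDynamics (Literature.MathematicalPhysics.KineticTheory.HeatConduction.OscillatorChain.mk (fun q => μ * q ^ 4 / 4) (fun r => r ^ 4 / 4) γ)), (Literature.MathematicalPhysics.KineticTheory.HeatConduction.OscillatorChain.mk (fun q => μ * q ^ 4 / 4) (fun r => r ^ 4 / 4) γ).IsChainGibbsMeasure 1 ρ → (∀ x : ℤ, MeasureTheory.MeasurePreserving (fun σ : Literature.MathematicalPhysics.KineticTheory.HeatConduction.ChainConfig =>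 fun i : ℤ => σ (i + x)) ρ ρ) → D.PreservesMeasure ρ → (∀ t : ℝ, D.HasAbsConvergentCorrelation ρ t) → ∀ σ : MeasureTheory.Measure ℝ, MeasureTheory.IsFiniteMeasure σ → (∀ t : ℝ, D.currentCorrelation ρ t = MeasureTheory.integral σ (fun ω : ℝ => Real.cos (ω * t))) → σ {0} = 0) →
    (∀ μ γ : ℝ, 0 < μ → ∀ (ρ : MeasureTheory.Measure Literature.MathematicalPhysics.KineticTheory.HeatConduction.ChainConfig) (D : Literature.MathematicalPhysics.KineticTheory.HeatConduction.InfiniteChainDynamics (Literature.MathematicalPhysics.KineticTheory.HeatConduction.OscillatorChain.mk (fun q => μ * q ^ 4 / 4) (fun r => r ^ 4 / 4) γ)), (Literature.MathematicalPhysics.KineticTheory.HeatConduction.OscillatorChain.mk (fun q => μ * q ^ 4 / 4) (fun r => r ^ 4 / 4) γ).IsChainGibbsMeasure 1 ρ → (∀ x : ℤ, MeasureTheory.MeasurePreserving (fun σ : Literature.MathematicalPhysics.KineticTheory.HeatConduction.ChainConfig => fun i : ℤ => σ (i + x)) ρ ρ) → D.PreservesMeasure ρ → (∀ t : ℝ,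 D.HasAbsConvergentCorrelation ρ t) → ∀ (σ : MeasureTheory.Measure ℝ) (δ : ℝ) (g : ℝ → ℝ), MeasureTheory.IsFiniteMeasure σ → 0 < δ → (∀ t : ℝ, D.currentCorrelation ρ t = MeasureTheory.integral σ (fun ω : ℝ => Real.cos (ω * t))) → ContinuousOn g (Set.Ioo (-δ) δ) → (∀ ω ∈ Set.Ioo (-δ) δ, 0 ≤ g ω) → σ.restrict (Set.Ioo (-δ) δ) = (MeasureTheory.volume.restrict (Set.Ioo (-δ) δ)).withDensity (fun ω => ENNReal.ofReal (g ω)) → 0 < g 0) →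
      Summit.AtomisticToContinuum.FouriersLaw.Theses.PorousMediumCorner.AnchorAbelGreenKubo := by
  intro hSetup hWin hND hPD μ γ hμ
  obtain ⟨ρ, D, hG, hS, hP, hA, σ₀, hfin₀, hC₀⟩ := hSetup μ γ hμ
  haveI : IsFiniteMeasure σ₀ := hfin₀
  -- symmetrise the spectral measure: even, finite, same cosine transform
  obtain ⟨σ, hfin, heven, hcos⟩ := exists_even_measure_integral_cos_eq σ₀
  have hC : ∀ t : ℝ, D.currentCorrelation ρ t = ∫ ω, Real.cos (ω * t) ∂σ := fun t => by
    rw [hcos t]; exact hC₀ t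
  -- the low-frequency window of the even representation
  obtain ⟨δ, g, hδ, hg, hg0, hres⟩ := hWin μ γ hμ ρ D hG hS hP hA σ hfin heven hC
  -- no Drude weight: the atom at frequency 0 vanishes
  have hatom : σ {0} = 0 := hND μ γ hμ ρ D hG hS hP hA σ hfin hC
  rw [hatom, zero_smul, zero_add] at hres
  -- not an insulator
  have hpos : 0 < g 0 := hPD μ γ hμ ρ D hG hS hP hA σ δ g hfin hδ hC hg hg0 hres
  -- the Abelian (Poisson-kernel) lemma computes the Abel limit
  have hlim := abel_of_spectralDensity σ (D.currentCorrelation ρ) δ g hfin hδ hC hg hg0 hres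
  exact ⟨ρ, D, Real.pi * g 0, hG, hP, hA, by positivity, hlim⟩

end Summit.AtomisticToContinuum.FouriersLaw.Theorems.PorousMediumCornerSplit

end
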